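import Literature.IUT.HodgeTheaters.FPrimeStripsRigidity
import HarnessLib

/-!
# [IUTchI] Remark 5.2.1 (ii) `RlfOfIsStrip` ("`‡𝔉 ↦ ‡𝔉^⊩` forms an `ℱ^⊩`-prime-strip"): the typed FACT is a
# SCHEMA — equivalent to ONE kit law, consistent, and independent of the interface axioms (PROOF-ONLY)

Mochizuki, *Inter-universal Teichmüller theory I*, kurims manuscript (May 2020), §5, Remark 5.2.1 (ii), p. 143:
*"one may also construct from the `ℱ`-prime-strip `‡𝔉`, via a functorial algorithm [cf. the constructions of Example
3.5, (i), (ii)], a collection of data `‡𝔉 ↦ ‡𝔉^⊩ := (‡𝒞^⊩, Prime(‡𝒞^⊩) ⥲ 𝕍, ‡𝔉^⊢, {‡ρ_v}_{v∈𝕍})` … which is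
isomorphic to the collection of data `ℱ^⊩_mod` of Example 3.5, (ii), i.e., which forms an `ℱ^⊩`-prime-strip"*
([IUTchI] Rmk 5.2.1 (ii) p.143) [claim: Mochizuki2012, status: disputed].  The cell types this claim as the
`Prop`-valued field-free predicate `PMBaseKit.FKit.RlfOfIsStrip FK : ∀ F : FK.FStrip, Nonempty (FK.rlfOf F.obj ≅ FK.rlfModel)`
over abc-iut-L5-t4's interface `FKit` (`FPrimeStrips.lean`); FACT-LIST row **F-1998** (plan/F-TRANCHES.tsv tranche 187).

PROOF-ONLY (no `def`, no instance; abc-iut-w4-d073 gen 4, F-TRANCHES programme D-0078).  What the kernel says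
about the ROW AS TYPED (universal closure over all kits):
* `rlfOfIsStrip_iff_model` — for EVERY kit, `RlfOfIsStrip FK ↔ Nonempty (FK.rlfOf FK.fModel ≅ FK.rlfModel)`: since the
  algorithm is functorial on isomorphisms (`rlfOfMap`) and every `ℱ`-prime-strip is strip-wise an isomorph of the model,
  the printed claim is EXACTLY the one interface law "the algorithm sends the model `ℱ`-prime-strip to an isomorph of
  `ℱ^⊩_mod`" (the content print attributes to "the constructions of Example 3.5, (i), (ii)");
* CONSISTENCY is abc-iut-L5-t4's `rlfOfIsStrip_toy` (`FPrimeStripsRigidity.lean`; restated as `rlfOfIsStrip_toy'` through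
  the reduction);
* `exists_fkit_not_rlfOfIsStrip` — INDEPENDENCE: over the same toy base kit there is an `FKit` (the algorithm lands on an
  object of a two-object discrete category that is NOT the model) for which `RlfOfIsStrip` FAILS; hence
  `not_forall_rlfOfIsStrip` — the universal closure of the row is REFUTED (the row is a hypothesis on the kit, not a
  theorem of the interface): FACT-LIST class SCHEMA (consistent ∧ independent), to be consumed BY NAME as the cell does
  (`FStrip.rlf`, `nonempty_rlfFm_rlfModel_iso_of_rlfOfIsStrip`, `cor56iKit_iff_component_bijective_of_rlfOfIsStrip`).
No new Prop fact; no statement of the paper is strengthened; no side is taken on [IUTchIII] Cor. 3.12.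
-/

namespace Literature.IUT.HodgeTheaters

open CategoryTheory

universe u

namespace PMBaseKit

namespace FKit

variable {l : ℕ} {K : PMBaseKit.{u} l} {M : K.MultKit} {FK : K.FKit M}

/-! ### The reduction to one kit law -/

/-- **`RlfOfIsStrip` IS the single law "`rlfOf` (model `ℱ`-prime-strip) ≅ `ℱ^⊩_mod`"**: the algorithm
`‡𝔉 ↦ ‡𝔉^⊩` is functorial on isomorphisms (`rlfOfMap`) and every `ℱ`-prime-strip is an isomorph of the model strip.
([IUTchI] Rmk 5.2.1 (ii) p.143) [claim: Mochizuki2012, status: disputed] -/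
theorem rlfOfIsStrip_iff_model : FK.RlfOfIsStrip ↔ Nonempty (FK.rlfOf FK.fModel ≅ FK.rlfModel) := by
  constructor
  · intro h
    exact h ⟨FK.fModel, fun _ => ⟨Iso.refl _⟩⟩
  · rintro ⟨e⟩ F
    exact ⟨FK.rlfOfMap (fun v => (F.isModel v).some) ≪≫ e⟩

/-- The law for the model strip, extracted from `RlfOfIsStrip`. ([IUTchI] Rmk 5.2.1 (ii) p.143)
[claim: Mochizuki2012, status: disputed] -/
theorem nonempty_rlfOf_fModel_iso_of_rlfOfIsStrip (h : FK.RlfOfIsStrip) :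
    Nonempty (FK.rlfOf FK.fModel ≅ FK.rlfModel) :=
  rlfOfIsStrip_iff_model.mp h

/-- … and conversely: a kit whose algorithm sends the model strip to an isomorph of `ℱ^⊩_mod` satisfies the printed claim
for EVERY `ℱ`-prime-strip. ([IUTchI] Rmk 5.2.1 (ii) p.143) [claim: Mochizuki2012, status: disputed] -/
theorem rlfOfIsStrip_of_model (e : FK.rlfOf FK.fModel ≅ FK.rlfModel) : FK.RlfOfIsStrip :=
  rlfOfIsStrip_iff_model.mpr ⟨e⟩

/-! ### Consistency and independence over the toy base kit -/

section Witness

variable (l : ℕ) [Fact l.Prime] (hl : l ≠ 2)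

/-- CONSISTENCY through the reduction: for abc-iut-L5-t4's toy kit `rlfOf` is the identity of the product category and
the model strip IS `ℱ^⊩_mod` (cf. `rlfOfIsStrip_toy`). ([IUTchI] Rmk 5.2.1 (ii) p.143) [claim: Mochizuki2012, status: disputed] -/
theorem rlfOfIsStrip_toy' : (FKit.toy l hl).RlfOfIsStrip :=
  rlfOfIsStrip_of_model (Iso.refl _)

/-- **INDEPENDENCE of Rmk 5.2.1 (ii) as typed from the interface axioms**: over the toy base kit there is an `FKit`
whose `ℱ^⊩`-ambient category is the discrete category on `Bool`, with model `ℱ^⊩_mod := false` and algorithm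
`‡𝔉 ↦ true` (functorial: identities), for which `RlfOfIsStrip` FAILS (`true ≇ false` in a discrete category).
So the named statement carries content beyond the kit axioms — the content print attributes to "the constructions
of Example 3.5, (i), (ii)". ([IUTchI] Rmk 5.2.1 (ii) p.143) [claim: Mochizuki2012, status: disputed] -/
theorem exists_fkit_not_rlfOfIsStrip :
    ∃ FK : (toyKit l hl).FKit (MultKit.toy l hl), ¬ FK.RlfOfIsStrip := by
  classical
  refine ⟨{ FAmb := fun _ => Discrete PUnit.{1}
            fModel := fun _ => ⟨⟨⟩⟩
            FmAmb := (FKit.toy l hl).FmAmb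
            fmModel := (FKit.toy l hl).fmModel
            toD := fun _ => (Functor.const _).obj Model.Obj.loc
            toD_model := fun _ => Iso.refl _
            toFm := fun _ => (Functor.const _).obj Model.Obj.loc
            toFm_model := fun _ => Iso.refl _
            RlfAmb := Discrete Bool
            rlfModel := ⟨false⟩
            rlfFm := fun _ => (Functor.const _).obj Model.Obj.loc
            rlfOf := fun _ => ⟨true⟩
            rlfOfMap := fun _ => Iso.refl _
            rlfFm_rlfOf := fun _ _ => Iso.refl _
            ThAmb := fun _ => Discrete PUnit.{1}
            thModel := fun _ => ⟨⟨⟩⟩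
            thToF := fun _ => 𝟭 _
            thToF_model := fun _ => Iso.refl _
            toDm := fun _ => SingleObj.star _
            toDmMap := fun _ => 𝟙 _
            toDm_toFm := fun _ _ => ⟨𝟙 _⟩ }, fun h => ?_⟩
  obtain ⟨e⟩ := rlfOfIsStrip_iff_model.mp h
  exact Bool.noConfusion (Discrete.eq_of_hom e.hom)

/-- **The universal closure of FACT row F-1998 is REFUTED**: `RlfOfIsStrip` does not hold for every kit over every base
kit (already over the toy base kit). ([IUTchI] Rmk 5.2.1 (ii) p.143) [claim: Mochizuki2012, status: disputed] -/
theorem not_forall_rlfOfIsStrip :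
    ¬ ∀ FK : (toyKit l hl).FKit (MultKit.toy l hl), FK.RlfOfIsStrip := by
  obtain ⟨FK, hFK⟩ := exists_fkit_not_rlfOfIsStrip l hl
  exact fun h => hFK (h FK)

/-- The row is a SCHEMA: over one and the same base kit it holds for one `FKit` and fails for another.
([IUTchI] Rmk 5.2.1 (ii) p.143) [claim: Mochizuki2012, status: disputed] -/
theorem rlfOfIsStrip_schema :
    (∃ FK : (toyKit l hl).FKit (MultKit.toy l hl), FK.RlfOfIsStrip) ∧
      ∃ FK : (toyKit l hl).FKit (MultKit.toy l hl), ¬ FK.RlfOfIsStrip :=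
  ⟨⟨FKit.toy l hl, rlfOfIsStrip_toy' l hl⟩, exists_fkit_not_rlfOfIsStrip l hl⟩

end Witness

end FKit

end PMBaseKit

end Literature.IUT.HodgeTheaters
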